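import Literature.AlgebraicGeometry.HodgeTheory.VHSDataExceptionalHodgeLocusOverCurve
import Literature.AlgebraicGeometry.HodgeTheory.VHSDataHodgeLocusRankJump
import Literature.AlgebraicGeometry.HodgeTheory.VHSDataComapCharts
import Literature.AlgebraicGeometry.Motives.FamiliesVHSComapCovering
import Literature.AlgebraicGeometry.Motives.FamiliesVHSIso
import HarnessLib

/-!
# Classes of type `(p,p)` along paths under morphisms, isomorphisms and pull-back along covering maps: the exceptional (Noether–Lefschetz) locus of
# `f^*D` is `f⁻¹` of that of `D` («to prove 1.1 one is free to replace `S` by a finite etale covering»)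

Topic `Literature/AlgebraicGeometry/HodgeTheory` (namespace `Literature.AlgebraicGeometry.Motives.VHSData`), lane `lit-hodgefound` (seat `p08`, row
g61-#4); sequel of `VHSDataHodgeClassesAlongPaths` (`IsHodgeAlong`, `exceptionalHodgeLocus`), `VHSDataHodgeLocusRankJump` (`genericHodgeClasses`) and
`VHSDataExceptionalHodgeLocusOverCurve` (finiteness of the bounded non-generic classes over a punctured compact curve), in the style of
`Motives/FamiliesVHSComapCovering` and `VHSDataNonGenericHodgeClassesDescent` (the same for determination loci and the non-generic locus).  THEOREMS ONLY —
no definition, no named fact, no instance (D-0026 net debt `0`).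

PRINTED SOURCE, VERBATIM (E. Cattani, P. Deligne, A. Kaplan, *On the locus of Hodge classes*, J. AMS 8 (1995); held text `paper:arxiv-alg-geom_9402009`).
P. 483: «the locus `T ⊂ U` where `h` remains of type `(p,p)` … is a complex analytic subspace of `U`»; p. 484, Cor. 1.3: «Let `u` be a section of the
local system `𝒱_ℤ` on a universal covering of `S`. The set of points in `S` where some determination of `u` is of type `(0,0)`, is an algebraic
subvariety of `S`»; p. 485, «Proof of 1.5 ⟹ 1.1»: «To prove 1.1 one is free to replace `S` of 1.1 by a finite etale covering `S′ → S`.»  W. Schmid,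
Invent. Math. 22 (1973), §2 (morphisms of variations; flat frames).  P. Deligne, LNM 163 (1970), I.1 (inverse images of local systems).

CONTENT.
* §1 MORPHISMS AND ISOMORPHISMS: `Hom.isHodgeAlong_app` (a morphism of VHS data carries classes remaining of type `(p,p)` along `W` to such classes),
  `Iso.isHodgeAlong_hom_app_iff`, **`Iso.exceptionalHodgeLocus_eq`** (the exceptional locus is invariant under isomorphisms),
  `Iso.setOf_exceptional_le_eq` (the bounded part, for ISOMETRIC isomorphisms), and the generic class attached to a morphism:
  `Hom.isHodgeAlong_homClass_app` (the class of `φ` in `Hom(D₁, D₂)` remains of type `(0,0)` under every continuation).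
* §2 PULL-BACK ALONG A CONTINUOUS MAP `f : S′ → S`: `IsHodgeAlong.comap` (continuations upstairs are continuations along image paths),
  `genericHodgeClasses_le_comap`; ALONG A COVERING MAP (Mathlib `IsCoveringMap`, path lifting `liftPathQuotient`):
  **`genericHodgeClasses_comap`** (`Gen(f^*D)_{s′} = Gen(D)_{f s′}`), **`isHodgeAlong_univ_comap_iff`**, **`exceptionalHodgeLocus_comap`**
  (`= f⁻¹(exceptionalHodgeLocus D p)`), `setOf_exceptional_le_comap`, and the images under a surjective covering map
  (`image_exceptionalHodgeLocus_comap`, `image_setOf_exceptional_le_comap`).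
* §3 «REPLACE `S` BY A FINITE ÉTALE COVERING» — descent of the global conclusions along a surjective covering map: countability
  (`countable_exceptionalHodgeLocus_of_comap`), density of the complement (`dense_compl_exceptionalHodgeLocus_of_comap`), finiteness of the bounded
  part (`finite_setOf_exceptional_le_of_comap`); instantiated with flat interior charts of `f^*D` over a Lindelöf `S′` (`…_of_comap_of_charts`), with
  `f^*D` locally flat-charted over a punctured compact curve `S′` (`finite_setOf_exceptional_le_of_comap_of_compactification`), and with flat interior
  charts of `D` DOWNSTAIRS + flat puncture charts of `f^*D` UPSTAIRS through the sheets of `f` (`finite_setOf_exceptional_le_of_sheets`,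
  `IsLocallyFlatCharted.comap_of_sheets`).

HONEST SCOPE.  As in the prequels (`VHSData` and the charts are hypothesis structures; `dim = 1` where charts enter); covering maps are Mathlib's
`IsCoveringMap` (evenly covered neighbourhoods), finiteness of the fibres is never used; §1–§2 hold over any topological base.

## References

* [CattaniDeligneKaplan1995] E. Cattani, P. Deligne, A. Kaplan, *On the locus of Hodge classes*, J. Amer. Math. Soc. 8 (1995) 483–506: §1 (p. 483),
  Thm. 1.1, Cor. 1.2, Cor. 1.3 (p. 484), «Proof of 1.5 ⟹ 1.1» (p. 485), (2.4) (p. 488).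
* [VoisinHodgeII2003] C. Voisin, *Hodge Theory and Complex Algebraic Geometry II*, CUP (2003), §3.3.1–§3.3.2, §5.3.1 Def. 5.12, §5.3.3.
* [VoisinHodgeI2002] C. Voisin, *Hodge Theory and Complex Algebraic Geometry I*, CUP (2002), §7.3.1 (morphisms of Hodge structures), §9.2 (local systems).
* [Schmid1973] W. Schmid, *Variation of Hodge structure: the singularities of the period mapping*, Invent. Math. 22 (1973), §2.
* [Deligne1970] P. Deligne, *Équations différentielles à points singuliers réguliers*, LNM 163 (1970), I.1.
* [FritzscheGrauert2002] K. Fritzsche, H. Grauert, *From Holomorphic Functions to Complex Manifolds*, GTM 213 (2002), Ch. IV §1 (sheets of coverings).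
-/

noncomputable section

open scoped TensorProduct
open _root_.Topology _root_.Filter Set

universe u

namespace Literature.AlgebraicGeometry

open Motives Motives.HodgeStructure HodgeTheory Topology

namespace Motives.VHSData

variable {S : Type} [TopologicalSpace S] {S' : Type} [TopologicalSpace S'] {k : ℤ}

/-! ## §1 Morphisms and isomorphisms -/

section Morphisms

variable {D₁ D₂ : VHSData S k} {p : ℤ} {s : S} {W : Set S}

/-- **A morphism of VHS data carries classes remaining of type `(p,p)` along `W` to such classes** (it commutes with transport and preserves Hodge
classes). [cite: Schmid1973, §2] [cite: VoisinHodgeI2002, §7.3.1] [cite: CattaniDeligneKaplan1995, §1 (p. 483)] -/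
theorem Hom.isHodgeAlong_app (φ : Hom D₁ D₂) {u : D₁.VZ.fiber s} (h : D₁.IsHodgeAlong p u W) : D₂.IsHodgeAlong p (φ.app s u) W :=
  fun _ γ hγ => by
    rw [← φ.app_transport]
    exact φ.isHodgeAt_app (h γ hγ)

/-- **Invariance under isomorphisms**: `hom_s u` remains of type `(p,p)` along `W` iff `u` does. [cite: Schmid1973, §2] [cite: CattaniDeligneKaplan1995, §1 (p. 483)] -/
theorem Iso.isHodgeAlong_hom_app_iff (e : Iso D₁ D₂) (u : D₁.VZ.fiber s) : D₂.IsHodgeAlong p (e.hom.app s u) W ↔ D₁.IsHodgeAlong p u W :=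
  ⟨fun h => by simpa only [Iso.inv_app_hom_app] using e.inv.isHodgeAlong_app h, fun h => e.hom.isHodgeAlong_app h⟩

/-- **THE EXCEPTIONAL HODGE LOCUS IS INVARIANT UNDER ISOMORPHISMS OF VHS DATA.** [cite: VoisinHodgeII2003, §5.3.3] [cite: CattaniDeligneKaplan1995, §1 (p. 483)] -/
theorem Iso.exceptionalHodgeLocus_eq (e : Iso D₁ D₂) (p : ℤ) : D₁.exceptionalHodgeLocus p = D₂.exceptionalHodgeLocus p := by
  ext s
  constructor
  · rintro ⟨u, hu, hnot⟩
    exact ⟨e.hom.app s u, (e.isHodgeAt_hom_app_iff s p u).2 hu, fun h => hnot ((e.isHodgeAlong_hom_app_iff u).1 h)⟩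
  · rintro ⟨v, hv, hnot⟩
    exact ⟨e.inv.app s v, (e.isHodgeAt_inv_app_iff s p v).2 hv, fun h => hnot ((e.symm.isHodgeAlong_hom_app_iff v).1 h)⟩

/-- The bounded part `{s | ∃ u of type (p,p), Q(u,u) ≤ K, not generic}` is invariant under ISOMETRIC isomorphisms. [cite: CattaniDeligneKaplan1995, §1 (p. 484)] -/
theorem Iso.setOf_exceptional_le_eq (e : Iso D₁ D₂) (he : e.hom.IsIsometry) (p K : ℤ) :
    {s : S | ∃ u : D₁.VZ.fiber s, D₁.IsHodgeAt s p u ∧ (D₁.form s).form (D₁.toRat s u) (D₁.toRat s u) ≤ (K : ℚ) ∧ ¬ D₁.IsHodgeAlong p u univ} =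
      {s : S | ∃ v : D₂.VZ.fiber s, D₂.IsHodgeAt s p v ∧ (D₂.form s).form (D₂.toRat s v) (D₂.toRat s v) ≤ (K : ℚ) ∧ ¬ D₂.IsHodgeAlong p v univ} := by
  ext s
  constructor
  · rintro ⟨u, hu, hK, hnot⟩
    exact ⟨e.hom.app s u, (e.isHodgeAt_hom_app_iff s p u).2 hu, by rwa [he.form_toRat_app], fun h => hnot ((e.isHodgeAlong_hom_app_iff u).1 h)⟩
  · rintro ⟨v, hv, hK, hnot⟩
    exact ⟨e.inv.app s v, (e.isHodgeAt_inv_app_iff s p v).2 hv, by rwa [(e.isIsometry_inv he).form_toRat_app],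
      fun h => hnot ((e.symm.isHodgeAlong_hom_app_iff v).1 h)⟩

/-- **The class of a morphism is a GENERIC Hodge class of `Hom(D₁, D₂)`**: the element `[φ_s] ∈ Hom(V₁,ℤ, V₂,ℤ)_s` remains of type `(0,0)` under every
continuation along every path (flatness of `φ` and compatibility with the Hodge filtrations at every point).
[cite: Schmid1973, §2] [cite: VoisinHodgeI2002, §7.3.1] [cite: Deligne1970, I.1] -/
theorem Hom.isHodgeAlong_homClass_app (φ : Hom D₁ D₂) (s : S) (W : Set S) : (D₁.hom D₂).IsHodgeAlong 0 (D₁.homClass D₂ s (φ.app s)) W :=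
  fun _ γ _ => φ.isHodgeAt_transport_homClass_app (Path.Homotopic.Quotient.mk γ)

end Morphisms

/-! ## §2 Pull-back along a continuous map, and along a covering map -/

section Comap

variable (D : VHSData S k) (f : C(S', S)) {p : ℤ}

/-- **Continuations of `f^*D` are continuations of `D` along image paths**: if `u ∈ V_ℤ,f(s′)` remains of type `(p,p)` for `D` along `W`, it remains of
type `(p,p)` for `f^*D` along `f⁻¹(W)`. [cite: Deligne1970, I.1] [cite: CattaniDeligneKaplan1995, Cor. 1.3 (p. 484)] -/
theorem IsHodgeAlong.comap {s' : S'} {u : D.VZ.fiber (f s')} {W : Set S} (h : D.IsHodgeAlong p u W) :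
    (D.comap f).IsHodgeAlong p (s := s') u (f ⁻¹' W) := fun t' γ' hγ' => by
  rw [isHodgeAt_comap_iff, comap_VZ_transport, ← Path.Homotopic.Quotient.mk_map]
  exact h (γ'.map f.continuous) fun τ => hγ' τ

/-- `Gen(D)_{f s′} ≤ Gen(f^*D)_{s′}`: a generic rational class of `D` at `f s′` is generic for `f^*D` at `s′`. [cite: Deligne1970, I.1] -/
theorem genericHodgeClasses_le_comap (p : ℤ) (s' : S') : D.genericHodgeClasses p (f s') ≤ (D.comap f).genericHodgeClasses p s' :=
  fun x hx t' γ' => by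
    rw [comap_hodge, comap_V_transport, ← Path.Homotopic.Quotient.mk_map]
    exact hx (γ'.map f.continuous)

variable {f}

/-- **ALONG A COVERING MAP THE GENERIC CLASSES UPSTAIRS AND DOWNSTAIRS COINCIDE: `Gen(f^*D)_{s′} = Gen(D)_{f s′}`** — every path of `S` from `f s′`
lifts to a path of `S′` from `s′` (`IsCoveringMap.liftPathQuotient`), and the transports agree. [cite: CattaniDeligneKaplan1995, Cor. 1.3 (p. 484)] [cite: Deligne1970, I.1] -/
theorem genericHodgeClasses_comap (hf : IsCoveringMap f) (p : ℤ) (s' : S') : (D.comap f).genericHodgeClasses p s' = D.genericHodgeClasses p (f s') := by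
  refine le_antisymm (fun x hx t γ => ?_) (D.genericHodgeClasses_le_comap f p s')
  -- lift the path class `⟦γ⟧` to `S′` from `s′`
  have key : ∀ (m : f ⁻¹' {t}) (γ' : Path.Homotopic.Quotient s' m.1), γ'.map f = (Path.Homotopic.Quotient.mk γ).cast rfl m.2 →
      (D.comap f).V.transport γ' x ∈ ((D.comap f).hodge m.1).hodgeClasses p →
      D.V.transport (Path.Homotopic.Quotient.mk γ) x ∈ (D.hodge t).hodgeClasses p := by
    rintro ⟨t', ht'⟩ γ' hγ' H
    change f t' = t at ht'
    subst ht'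
    rw [comap_hodge, comap_V_transport, hγ', Path.Homotopic.Quotient.cast_rfl_rfl] at H
    exact H
  set γq := Path.Homotopic.Quotient.mk γ with hγq
  obtain ⟨Γ, hΓ⟩ := Path.Homotopic.Quotient.mk_surjective (hf.liftPathQuotient γq ⟨s', rfl⟩)
  refine key _ (hf.liftPathQuotient γq ⟨s', rfl⟩) (hf.map_liftPathQuotient γq ⟨s', rfl⟩) ?_
  rw [← hΓ]
  exact hx Γ

/-- **ALONG A COVERING MAP: `u ∈ V_ℤ,f(s′)` is generic for `f^*D` at `s′` iff it is generic for `D` at `f s′`** (every continuation downstairs is a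
continuation upstairs along the lifted path). [cite: CattaniDeligneKaplan1995, Cor. 1.3 (p. 484), «Proof of 1.5 ⟹ 1.1» (p. 485)] [cite: Deligne1970, I.1] -/
theorem isHodgeAlong_univ_comap_iff (hf : IsCoveringMap f) {s' : S'} (u : D.VZ.fiber (f s')) :
    (D.comap f).IsHodgeAlong p (s := s') u univ ↔ D.IsHodgeAlong p u univ := by
  rw [isHodgeAlong_univ_iff_toRat_mem, isHodgeAlong_univ_iff_toRat_mem, comap_toRat, D.genericHodgeClasses_comap hf p s']
  exact Iff.rfl

/-- **THE EXCEPTIONAL HODGE LOCUS OF `f^*D` IS `f⁻¹` OF THAT OF `D`** for a covering map `f`. [cite: CattaniDeligneKaplan1995, «Proof of 1.5 ⟹ 1.1» (p. 485)]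
[cite: VoisinHodgeII2003, §5.3.3] -/
theorem exceptionalHodgeLocus_comap (hf : IsCoveringMap f) (p : ℤ) : (D.comap f).exceptionalHodgeLocus p = f ⁻¹' D.exceptionalHodgeLocus p := by
  ext s'
  rw [mem_preimage, mem_exceptionalHodgeLocus_iff, mem_exceptionalHodgeLocus_iff]
  refine exists_congr fun u => ?_
  rw [isHodgeAt_comap_iff, D.isHodgeAlong_univ_comap_iff hf u]

/-- The bounded part pulls back the same way: `{s′ | ∃ u of type (p,p), Q(u,u) ≤ K, not generic for f^*D} = f⁻¹{…for D}`.
[cite: CattaniDeligneKaplan1995, Thm. 1.1 (p. 484), «Proof of 1.5 ⟹ 1.1» (p. 485)] -/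
theorem setOf_exceptional_le_comap (hf : IsCoveringMap f) (p K : ℤ) :
    {s' : S' | ∃ u : (D.comap f).VZ.fiber s', (D.comap f).IsHodgeAt s' p u ∧
        ((D.comap f).form s').form ((D.comap f).toRat s' u) ((D.comap f).toRat s' u) ≤ (K : ℚ) ∧ ¬ (D.comap f).IsHodgeAlong p u univ} =
      f ⁻¹' {s : S | ∃ u : D.VZ.fiber s, D.IsHodgeAt s p u ∧ (D.form s).form (D.toRat s u) (D.toRat s u) ≤ (K : ℚ) ∧ ¬ D.IsHodgeAlong p u univ} := by
  ext s'
  rw [mem_preimage, mem_setOf_eq, mem_setOf_eq]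
  refine exists_congr fun u => ?_
  rw [isHodgeAt_comap_iff, comap_form, comap_toRat, D.isHodgeAlong_univ_comap_iff hf u]
  exact Iff.rfl

/-- **`f(exceptional locus of f^*D) = exceptional locus of D`** for a SURJECTIVE covering map. [cite: CattaniDeligneKaplan1995, «Proof of 1.5 ⟹ 1.1» (p. 485)] -/
theorem image_exceptionalHodgeLocus_comap (hf : IsCoveringMap f) (hsurj : Function.Surjective f) (p : ℤ) :
    f '' (D.comap f).exceptionalHodgeLocus p = D.exceptionalHodgeLocus p := by
  rw [D.exceptionalHodgeLocus_comap hf p, image_preimage_eq _ hsurj]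

/-- The image of the bounded part under a surjective covering map. [cite: CattaniDeligneKaplan1995, «Proof of 1.5 ⟹ 1.1» (p. 485)] -/
theorem image_setOf_exceptional_le_comap (hf : IsCoveringMap f) (hsurj : Function.Surjective f) (p K : ℤ) :
    f '' {s' : S' | ∃ u : (D.comap f).VZ.fiber s', (D.comap f).IsHodgeAt s' p u ∧
        ((D.comap f).form s').form ((D.comap f).toRat s' u) ((D.comap f).toRat s' u) ≤ (K : ℚ) ∧ ¬ (D.comap f).IsHodgeAlong p u univ} =
      {s : S | ∃ u : D.VZ.fiber s, D.IsHodgeAt s p u ∧ (D.form s).form (D.toRat s u) (D.toRat s u) ≤ (K : ℚ) ∧ ¬ D.IsHodgeAlong p u univ} := by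
  rw [D.setOf_exceptional_le_comap hf p K, image_preimage_eq _ hsurj]

/-- The generic ranks upstairs and downstairs agree along a covering map. [cite: CattaniDeligneKaplan1995, Cor. 1.3 (p. 484)] [cite: VoisinHodgeII2003, §3.3.1] -/
theorem finrank_genericHodgeClasses_comap (hf : IsCoveringMap f) (p : ℤ) (s' : S') :
    Module.finrank ℚ ((D.comap f).genericHodgeClasses p s') = Module.finrank ℚ (D.genericHodgeClasses p (f s')) := by
  rw [D.genericHodgeClasses_comap hf p s']
  rfl

end Comap

/-! ## §3 «Replace `S` by a finite étale covering»: descent of the global conclusions -/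

section Descent

variable (D : VHSData S k) {f : C(S', S)} {p : ℤ}

/-- **Countability of the exceptional locus DESCENDS along a surjective covering map.** [cite: CattaniDeligneKaplan1995, «Proof of 1.5 ⟹ 1.1» (p. 485)]
[cite: VoisinHodgeII2003, §3.3.2 (remark after Thm. 3.32)] -/
theorem countable_exceptionalHodgeLocus_of_comap (hf : IsCoveringMap f) (hsurj : Function.Surjective f)
    (h : ((D.comap f).exceptionalHodgeLocus p).Countable) : (D.exceptionalHodgeLocus p).Countable := by
  rw [← D.image_exceptionalHodgeLocus_comap hf hsurj p]
  exact h.image f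

/-- **Density of the complement of the exceptional locus DESCENDS along a surjective covering map** (`f` is continuous and onto).
[cite: CattaniDeligneKaplan1995, «Proof of 1.5 ⟹ 1.1» (p. 485)] [cite: VoisinHodgeII2003, §3.3.2 (remark after Thm. 3.32)] -/
theorem dense_compl_exceptionalHodgeLocus_of_comap (hf : IsCoveringMap f) (hsurj : Function.Surjective f)
    (h : Dense ((D.comap f).exceptionalHodgeLocus p)ᶜ) : Dense (D.exceptionalHodgeLocus p)ᶜ := by
  have heq : (D.exceptionalHodgeLocus p)ᶜ = f '' ((D.comap f).exceptionalHodgeLocus p)ᶜ := by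
    rw [D.exceptionalHodgeLocus_comap hf p, ← preimage_compl, image_preimage_eq _ hsurj]
  rw [heq]
  exact hsurj.denseRange.dense_image f.continuous h

/-- **Finiteness of the bounded non-generic part DESCENDS along a surjective covering map.** [cite: CattaniDeligneKaplan1995, Thm. 1.1 (p. 484),
«Proof of 1.5 ⟹ 1.1» (p. 485)] -/
theorem finite_setOf_exceptional_le_of_comap (hf : IsCoveringMap f) (hsurj : Function.Surjective f) {K : ℤ}
    (h : {s' : S' | ∃ u : (D.comap f).VZ.fiber s', (D.comap f).IsHodgeAt s' p u ∧
        ((D.comap f).form s').form ((D.comap f).toRat s' u) ((D.comap f).toRat s' u) ≤ (K : ℚ) ∧ ¬ (D.comap f).IsHodgeAlong p u univ}.Finite) :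
    {s : S | ∃ u : D.VZ.fiber s, D.IsHodgeAt s p u ∧ (D.form s).form (D.toRat s u) (D.toRat s u) ≤ (K : ℚ) ∧ ¬ D.IsHodgeAlong p u univ}.Finite := by
  rw [← D.image_setOf_exceptional_le_comap hf hsurj p K]
  exact h.image f

/-- **THE EXCEPTIONAL LOCUS OF `D` IS COUNTABLE WITH DENSE COMPLEMENT, FROM FLAT INTERIOR CHARTS OF `f^*D` ON A LINDELÖF COVER `S′ → S`** (surjective
covering map). [cite: CattaniDeligneKaplan1995, Cor. 1.2 (p. 484), «Proof of 1.5 ⟹ 1.1» (p. 485)] [cite: VoisinHodgeII2003, §3.3.2 and §5.3.3] -/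
theorem countable_and_dense_compl_exceptionalHodgeLocus_of_comap_of_charts [LindelofSpace S'] (hf : IsCoveringMap f)
    (hsurj : Function.Surjective f)
    (hchart' : ∀ x' : S', ∃ (φ : OpenPartialHomeomorph S' ℂ) (V : Type) (_ : AddCommGroup V) (_ : Module ℚ V) (_ : FiniteDimensional ℚ V)
      (H₀ : HodgeStructure V k) (P₀ : H₀.Polarization) (C : (D.comap f).InteriorChart φ P₀), x' ∈ φ.source ∧ C.IsFlat) (p : ℤ) :
    (D.exceptionalHodgeLocus p).Countable ∧ Dense (D.exceptionalHodgeLocus p)ᶜ :=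
  ⟨D.countable_exceptionalHodgeLocus_of_comap hf hsurj (countable_exceptionalHodgeLocus_of_charts hchart' p),
    D.dense_compl_exceptionalHodgeLocus_of_comap hf hsurj (dense_compl_exceptionalHodgeLocus_of_charts hchart' p)⟩

variable {α' ι' : Type*} {ψ' : α' → OpenPartialHomeomorph S' ℂ} {σ' : ι' → ℂ → S'}
variable {X' : Type*} [TopologicalSpace X'] [CompactSpace X']

/-- **THE BOUNDED NON-GENERIC CLASSES OF `D` LIVE OVER FINITELY MANY POINTS, FROM FLAT CHARTS OF `f^*D` OVER A PUNCTURED COMPACT CURVE `S′ → S`**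
(surjective covering map; `f^*D` locally flat-charted by discs covering `S′` and ends read off a compactification `j′ : S′ ↪ X′`).
[cite: CattaniDeligneKaplan1995, Thm. 1.1, Cor. 1.2 (p. 484), «Proof of 1.5 ⟹ 1.1» (p. 485), 2.3 (p. 487)] -/
theorem finite_setOf_exceptional_le_of_comap_of_compactification (hf : IsCoveringMap f) (hsurj : Function.Surjective f)
    (h' : (D.comap f).IsLocallyFlatCharted ψ' σ') (hpk : p + p = k) (K : ℤ) (hcov' : ∀ x' : S', ∃ a, x' ∈ (ψ' a).source) (A' : ι' → ℝ)
    {j' : S' → X'} (hj' : IsEmbedding j') (pt : ι' → X') (hpS : ∀ i, pt i ∉ range j') (hcovX : ∀ x : X', x ∉ range j' → ∃ i, x = pt i)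
    (φ' : ι' → OpenPartialHomeomorph X' ℂ) (hp : ∀ i, pt i ∈ (φ' i).source) (hφp : ∀ i, φ' i (pt i) = 0)
    (hball : ∀ i, Metric.ball (0 : ℂ) (Real.exp (-(2 * Real.pi * A' i))) ⊆ (φ' i).target)
    (hσ : ∀ (i : ι') (z : ℂ), A' i < z.im → j' (σ' i z) = (φ' i).symm (Complex.exp (2 * Real.pi * Complex.I * z))) :
    {s : S | ∃ u : D.VZ.fiber s, D.IsHodgeAt s p u ∧ (D.form s).form (D.toRat s u) (D.toRat s u) ≤ (K : ℚ) ∧ ¬ D.IsHodgeAlong p u univ}.Finite :=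
  D.finite_setOf_exceptional_le_of_comap hf hsurj
    (h'.finite_setOf_exceptional_le_of_compactification hpk K hcov' A' hj' pt hpS hcovX φ' hp hφp hball hσ)

/-- **THE SAME FROM FLAT INTERIOR CHARTS OF `D` DOWNSTAIRS AND FLAT PUNCTURE CHARTS OF `f^*D` UPSTAIRS, THROUGH THE SHEETS OF `f`** (sheets `e_b` of `f`
covering `S′`, discs `ψ_a` covering `S`; the flat interior charts of `f^*D` on the charts `ψ_a ∘ e_b` are induced: `IsLocallyFlatCharted.comap_of_sheets`;
compact core upstairs, end maps continuous and locally injective on open half-planes).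
[cite: CattaniDeligneKaplan1995, §1 (pp. 483–484), Thm. 1.1, «Proof of 1.5 ⟹ 1.1» (p. 485), (2.4) (p. 488)] [cite: FritzscheGrauert2002, Ch. IV §1] -/
theorem finite_setOf_exceptional_le_of_sheets {α β : Type*} (hf : IsCoveringMap f) (hsurj : Function.Surjective f)
    (ψ : α → OpenPartialHomeomorph S ℂ) (E : β → OpenPartialHomeomorph S' S) (hE : ∀ b x, E b x = f x)
    (hcov : ∀ y : S, ∃ a, y ∈ (ψ a).source) (hcov' : ∀ x : S', ∃ b, x ∈ (E b).source)
    (hint : ∀ a, ∀ y ∈ (ψ a).source, ∃ r > 0, Metric.ball (ψ a y) r ⊆ (ψ a).target ∧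
      ∃ (V : Type) (_ : AddCommGroup V) (_ : Module ℚ V) (_ : FiniteDimensional ℚ V) (H₀ : HodgeStructure V k) (P₀ : H₀.Polarization)
        (C : D.InteriorChart (restrBall (ψ a) y r) P₀), C.IsFlat)
    (hpunct : ∀ i, ∃ (V : Type) (_ : AddCommGroup V) (_ : Module ℚ V) (_ : FiniteDimensional ℚ V) (L : PolarizedLimitMixedHodgeStructure V k)
      (C : (D.comap f).PunctureChart (σ' i) L), C.IsFlat)
    (hpk : p + p = k) (K : ℤ) (A' : ι' → ℝ)
    (hcore' : ∀ A'' : ι' → ℝ, (∀ i, A' i ≤ A'' i) → ∃ K₀ : Set S', IsCompact K₀ ∧ K₀ ∪ ⋃ i, σ' i '' {z : ℂ | A'' i < z.im} = univ)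
    (hcont' : ∀ i, ContinuousOn (σ' i) {z : ℂ | A' i < z.im}) (hinj' : ∀ (i : ι') (z : ℂ), A' i < z.im → ∃ ρ > 0, Set.InjOn (σ' i) (Metric.ball z ρ)) :
    {s : S | ∃ u : D.VZ.fiber s, D.IsHodgeAt s p u ∧ (D.form s).form (D.toRat s u) (D.toRat s u) ≤ (K : ℚ) ∧ ¬ D.IsHodgeAlong p u univ}.Finite :=
  D.finite_setOf_exceptional_le_of_comap hf hsurj
    ((IsLocallyFlatCharted.comap_of_sheets f ψ E hE hint hpunct).finite_setOf_exceptional_le hpk K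
      (exists_mem_sheetChart_source ψ E hE hcov hcov') A' hcore' hcont' hinj')

end Descent

end Motives.VHSData

end Literature.AlgebraicGeometry

end
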